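import Summits.NavierStokesRegularity.NavierStokesRegularity.Theorems.EfficiencyFloorProductionEfficiencyDecayTypeIStratum
import HarnessLib

/-!
# Crux `EfficiencyFloor.ProductionEfficiencyDecay` (stmt-NavierStokesRegularity-22866): a STRATUM-FREE sufficient
# criterion — the pointwise crux holds along every blow-up whose velocity-gradient sup-norm is `o(Z²)`

Helper file (`--supports stmt-NavierStokesRegularity-22866`; line `efficiency_floor`; companion of
`…ProductionEfficiencyDecayTypeIStratum`, p829334/p829398). No registered stub and no crux is closed here.

The one-instant inequality `S = ∫⟪ω, ∇u ω⟫ ≤ ‖∇u(t)‖_∞ · Z(t)` (`TypeIStratum.stretching_le_of_norm_fderiv_le`) turns the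
registered crux-proper stub S2 (`Ż = 2S − 2ν·Pal ≤ ε Z³` eventually, every `ε`) into a comparison of TWO blow-up
quantities of the same solution, with no Type-I hypothesis:

* `depletion_of_fderiv_small` (ONE solution, registered-stub currency): if for every `δ > 0`, eventually as `t ↑ T`,
  `‖∇u(t,x)‖ ≤ δ · Z(t)²` for all `x` (`Z(t) = (∫⁻‖curl u(t)‖ₑ²).toReal`, the intrinsic enstrophy) — i.e.
  `‖∇u(t)‖_∞ = o(Z(t)²)` — then for every budget triple and every `ε > 0`, eventually `0 < Z ∧ 2S − 2ν·Pal ≤ ε Z³`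
  (positivity from the landed divergence of the enstrophy, stmt-22867);
* `efficiencyDecayLaw_of_fderiv_small` (ONE solution, crux currency): the same hypothesis gives the crux's ε-law
  (`0 < Z < ⊤` on a late window and `Z(s)⁻² − Z(t)⁻² ≤ ε(t−s)`);
* BY NAME: `stub_depletionGivenBudget_of_fderiv_small` (the registered stub S2, signature verbatim, from the gradient
  criterion assumed along every first blow-up) and `productionEfficiencyDecay_of_fderiv_small`;
* `fderiv_small_of_isTypeIBlowup_of_floor`: on a velocity-Type-I blow-up the super-Leray floor IMPLIES the gradient
  criterion (KNSS rate `‖∇u‖_∞ ≤ C/(T−t)` and `Z²(T−t) → ∞`), so `…TypeIStratum` §2 factors through this file.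

READING. `ν³‖∇u‖_∞/Z²` is invariant under the Navier–Stokes scaling; for a single-scale profile of speed `U` and
length `L` one has `‖∇u‖_∞ ∼ U/L`, `Z ∼ U²L`, so the criterion `‖∇u‖_∞ ≪ Z²` reads `(UL)³ ≫ 1` — divergence of the
local Reynolds number `UL/ν` of the collapsing structure (heuristic only; borderline exactly on self-similar = Type-I
profiles, where `…TypeIStratum` shows the criterion is then equivalent to the floor). The a-priori bound
`sup_t ‖curl u(t)‖_{L¹} < ∞` (Constantin 1990) gives `Z ≤ ‖curl u‖_∞ ‖curl u‖₁ ≲ ‖∇u‖_∞`, so the criterion is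
compatible with, and not implied by, anything landed. HONEST FRAMING: a sufficient condition for an OPEN statement about
HYPOTHETICAL blow-ups; the gradient criterion itself is not claimed for any blow-up; stmt-22866 and Navier–Stokes
regularity are NOT proved; no registered stub or crux is closed; no summit statement is proved. [folklore]
-/

-- the problem directory repeats the summit name (`NavierStokesRegularity/NavierStokesRegularity`)
set_option linter.dupNamespace false

noncomputable section

open Set Filter MeasureTheory Topology Function
open scoped InnerProductSpace ENNReal NNReal ContDiff
open Literature.Analysis.FluidPDE

namespace Summit.NavierStokesRegularity.NavierStokesRegularity.Theorems

namespace ProductionEfficiencyDecay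

namespace GradientCriterion

/-! ### §1 One solution, registered-stub currency -/

/-- **`‖∇u‖_∞ = o(Z²)` ⟹ pointwise efficiency decay (ONE solution).** Along a maximal smooth Leray–Hopf
rapidly-decaying-datum solution on `[0,T)`: if for every `δ > 0`, eventually as `t ↑ T`, `‖∇u(t,x)‖ ≤ δ·Z(t)²` for all
`x` (intrinsic enstrophy `Z(t) = (∫⁻‖curl u(t)‖ₑ²).toReal`), then every budget triple `(Z, Pal, S)` (clauses of
stmt-22995 verbatim) satisfies, for every `ε > 0`, eventually `0 < Z ∧ 2S − 2ν·Pal ≤ ε Z³` — the conclusion of the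
registered crux-proper stub `stub_depletionGivenBudget` for this solution. (`2S ≤ 2‖∇u‖_∞ Z ≤ 2δ Z³` with `δ = ε/2`;
`Z ≥ 1` late by stmt-22867.) [folklore] -/
theorem depletion_of_fderiv_small {c ν T : ℝ} (hν : 0 < ν) (hT : 0 < T)
    {u : ℝ → EuclideanSpace ℝ (Fin 3) → EuclideanSpace ℝ (Fin 3)} {p : ℝ → EuclideanSpace ℝ (Fin 3) → ℝ}
    (hmax : IsMaximalSmoothSolution ν 0 u p T) (hLH : IsLerayHopfOn T ν 0 (u 0) u)
    (hdec : HasRapidSpatialDecay (u 0))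
    (hsmall : ∀ δ : ℝ, 0 < δ → ∀ᶠ t in 𝓝[<] T, ∀ x,
      ‖fderiv ℝ (u t) x‖ ≤ δ * ((∫⁻ y, ‖curl (u t) y‖ₑ ^ 2).toReal) ^ 2)
    {Zr Pr Sr : ℝ → ℝ}
    (hZ : ∀ t ∈ Set.Ioo 0 T, ∫⁻ x, ‖curl (u t) x‖ₑ ^ 2 = ENNReal.ofReal (Zr t) ∧ 0 ≤ Zr t ∧ 0 ≤ Pr t ∧
      Pr t = ∫ x, frobeniusNormSq (fderiv ℝ (curl (u t)) x) ∧
      Sr t = ∫ x, ⟪curl (u t) x, fderiv ℝ (u t) x (curl (u t) x)⟫_ℝ ∧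
      HasDerivAt Zr (2 * Sr t - 2 * ν * Pr t) t ∧ |Sr t| ≤ c * Zr t ^ (3/4 : ℝ) * Pr t ^ (3/4 : ℝ))
    {ε : ℝ} (hε : 0 < ε) :
    ∃ t₁ ∈ Set.Ioo 0 T, ∀ t ∈ Set.Ico t₁ T, 0 < Zr t ∧ 2 * Sr t - 2 * ν * Pr t ≤ ε * Zr t ^ 3 := by
  have hIoo : ∀ᶠ t in 𝓝[<] T, t ∈ Ioo 0 T := Ioo_mem_nhdsLT hT
  have hone : ∀ᶠ t in 𝓝[<] T, ENNReal.ofReal 1 ≤ ∫⁻ x, ‖curl (u t) x‖ₑ ^ 2 :=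
    BlowupEnstrophyUnbounded.main hν hT hmax hLH hdec 1
  have hall := hIoo.and ((hsmall (ε / 2) (half_pos hε)).and hone)
  obtain ⟨T₁, hT₁T, hsub⟩ := mem_nhdsLT_iff_exists_Ioo_subset.1 hall
  set t₁ : ℝ := (max T₁ 0 + T) / 2 with ht₁
  have hm : max T₁ 0 < T := max_lt hT₁T hT
  have ht₁I : t₁ ∈ Ioo 0 T := ⟨by rw [ht₁]; linarith [le_max_right T₁ 0], by rw [ht₁]; linarith⟩
  refine ⟨t₁, ht₁I, fun t ht => ?_⟩
  have hT₁t : T₁ < t := by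
    have : max T₁ 0 < t₁ := by rw [ht₁]; linarith
    exact (le_max_left T₁ 0).trans_lt (this.trans_le ht.1)
  obtain ⟨htI, hgrad, hge⟩ := hsub ⟨hT₁t, ht.2⟩
  obtain ⟨hZeq, hZ0, hP0, -, hSeq, -, -⟩ := hZ t htI
  obtain ⟨hsm, -, hsob, hZint⟩ := Violation.slice_data hν hT hmax hLH hdec htI hZeq hZ0
  -- `Zr t ≥ 1`
  rw [hZeq] at hge
  have hZ1 : 1 ≤ Zr t := (ENNReal.ofReal_le_ofReal_iff hZ0).1 hge
  have hZpos : 0 < Zr t := one_pos.trans_le hZ1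
  -- the intrinsic enstrophy is `Zr t`
  have hintr : (∫⁻ y, ‖curl (u t) y‖ₑ ^ 2).toReal = Zr t := by rw [hZeq, ENNReal.toReal_ofReal hZ0]
  have hgrad' : ∀ x, ‖fderiv ℝ (u t) x‖ ≤ ε / 2 * Zr t ^ 2 := fun x => by
    have h := hgrad x
    rwa [hintr] at h
  have hS : Sr t ≤ ε / 2 * Zr t ^ 2 * Zr t := by
    have h := TypeIStratum.stretching_le_of_norm_fderiv_le (hsm.of_le (by norm_cast)) (hsob 1) hgrad'
    rw [← hZint] at h
    rw [hSeq]
    exact h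
  have hνP : 0 ≤ 2 * ν * Pr t := by positivity
  refine ⟨hZpos, ?_⟩
  calc 2 * Sr t - 2 * ν * Pr t ≤ 2 * Sr t := by linarith
    _ ≤ 2 * (ε / 2 * Zr t ^ 2 * Zr t) := by linarith
    _ = ε * Zr t ^ 3 := by ring

/-! ### §2 One solution, crux currency -/

/-- **`‖∇u‖_∞ = o(Z²)` ⟹ the crux's ε-law (ONE solution)**: window `0 < Z < ⊤` and `Z(s)⁻² − Z(t)⁻² ≤ ε(t−s)` on a
late window, for every `ε > 0` (budget stmt-22995 + §1 + the landed integration step `stub_integrateEfficiency`).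
[folklore] -/
theorem efficiencyDecayLaw_of_fderiv_small {ν T : ℝ} (hν : 0 < ν) (hT : 0 < T)
    {u : ℝ → EuclideanSpace ℝ (Fin 3) → EuclideanSpace ℝ (Fin 3)} {p : ℝ → EuclideanSpace ℝ (Fin 3) → ℝ}
    (hmax : IsMaximalSmoothSolution ν 0 u p T) (hLH : IsLerayHopfOn T ν 0 (u 0) u)
    (hdec : HasRapidSpatialDecay (u 0))
    (hsmall : ∀ δ : ℝ, 0 < δ → ∀ᶠ t in 𝓝[<] T, ∀ x,
      ‖fderiv ℝ (u t) x‖ ≤ δ * ((∫⁻ y, ‖curl (u t) y‖ₑ ^ 2).toReal) ^ 2) :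
    ∀ ε : ℝ, 0 < ε → ∃ t₁ ∈ Set.Ico 0 T, (∀ t ∈ Set.Ico t₁ T,
        0 < ∫⁻ x, ‖curl (u t) x‖ₑ ^ 2 ∧ ∫⁻ x, ‖curl (u t) x‖ₑ ^ 2 < ⊤) ∧
        ∀ s t : ℝ, t₁ ≤ s → s ≤ t → t < T →
          ((∫⁻ x, ‖curl (u s) x‖ₑ ^ 2).toReal)⁻¹ ^ 2 - ((∫⁻ x, ‖curl (u t) x‖ₑ ^ 2).toReal)⁻¹ ^ 2 ≤
            ε * (t - s) := by
  intro ε hε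
  obtain ⟨c, _, hB⟩ := EnstrophyBudget.main
  obtain ⟨Zr, Pr, Sr, hZ⟩ := hB ν T hν hT u p hmax hLH hdec
  obtain ⟨t₁, ht₁, hdep⟩ := depletion_of_fderiv_small hν hT hmax hLH hdec hsmall hZ (half_pos hε)
  have hIoo : ∀ t ∈ Ico t₁ T, t ∈ Ioo 0 T := fun t ht => ⟨ht₁.1.trans_le ht.1, ht.2⟩
  have hpos : ∀ t ∈ Ico t₁ T, 0 < Zr t := fun t ht => (hdep t ht).1
  have hder : ∀ t ∈ Ico t₁ T, ∃ D : ℝ, HasDerivAt Zr D t ∧ D ≤ ε / 2 * Zr t ^ 3 := fun t ht =>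
    ⟨2 * Sr t - 2 * ν * Pr t, (hZ t (hIoo t ht)).2.2.2.2.2.1, (hdep t ht).2⟩
  refine ⟨t₁, ⟨ht₁.1.le, ht₁.2⟩, fun t ht => ?_, fun s t hs hst htT => ?_⟩
  · rw [(hZ t (hIoo t ht)).1]
    exact ⟨ENNReal.ofReal_pos.2 (hpos t ht), ENNReal.ofReal_lt_top⟩
  · have hsI : s ∈ Ico t₁ T := ⟨hs, hst.trans_lt htT⟩
    have htI : t ∈ Ico t₁ T := ⟨hs.trans hst, htT⟩
    rw [(hZ s (hIoo s hsI)).1, (hZ t (hIoo t htI)).1, ENNReal.toReal_ofReal (hpos s hsI).le,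
      ENNReal.toReal_ofReal (hpos t htI).le]
    have h := ProductionEfficiencyDecay.stub_integrateEfficiency Zr t₁ T (ε / 2) hpos hder s t hs hst htT
    linarith

/-! ### §3 By name -/

/-- **The gradient criterion along every first blow-up ⟹ the registered crux-proper stub S2** (signature of
`stub_depletionGivenBudget` VERBATIM as the conclusion). Implication between statements about hypothetical blow-ups; the
stub is NOT closed. [folklore] -/
theorem stub_depletionGivenBudget_of_fderiv_small
    (hG : ∀ (ν T : ℝ), 0 < ν → 0 < T → ∀ (u : ℝ → EuclideanSpace ℝ (Fin 3) → EuclideanSpace ℝ (Fin 3)) (p : ℝ →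
      EuclideanSpace ℝ (Fin 3) → ℝ), Literature.Analysis.FluidPDE.IsMaximalSmoothSolution ν 0 u p T →
      Literature.Analysis.FluidPDE.IsLerayHopfOn T ν 0 (u 0) u → Literature.Analysis.FluidPDE.HasRapidSpatialDecay
      (u 0) → ∀ δ : ℝ, 0 < δ → ∀ᶠ t in nhdsWithin T (Set.Iio T), ∀ x,
      ‖fderiv ℝ (u t) x‖ ≤ δ * ((∫⁻ y, ‖Literature.Analysis.FluidPDE.curl (u t) y‖ₑ ^ 2).toReal) ^ 2) :
    ∀ (c ν T : ℝ), 0 < c → 0 < ν → 0 < T → ∀ (u : ℝ → EuclideanSpace ℝ (Fin 3) → EuclideanSpace ℝ (Fin 3)) (p : ℝ → EuclideanSpace ℝ (Fin 3) → ℝ), Literature.Analysis.FluidPDE.IsMaximalSmoothSolution ν 0 u p T → Literature.Analysis.FluidPDE.IsLerayHopfOn T ν 0 (u 0) u → Literature.Analysis.FluidPDE.HasRapidSpatialDecay (u 0) → ∀ (Zr Pr Sr : ℝ → ℝ), (∀ t ∈ Set.Ioo 0 T, ∫⁻ x, ‖Literature.Analysis.FluidPDE.curl (u t) x‖ₑ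 ^ 2 = ENNReal.ofReal (Zr t) ∧ 0 ≤ Zr t ∧ 0 ≤ Pr t ∧ Pr t = ∫ x, Literature.Analysis.FluidPDE.frobeniusNormSq (fderiv ℝ (Literature.Analysis.FluidPDE.curl (u t)) x) ∧ Sr t = ∫ x, ⟪Literature.Analysis.FluidPDE.curl (u t) x, fderiv ℝ (u t) x (Literature.Analysis.FluidPDE.curl (u t) x)⟫_ℝ ∧ HasDerivAt Zr (2 * Sr t - 2 * ν * Pr t) t ∧ |Sr t| ≤ c * Zr t ^ (3/4 : ℝ) * Pr t ^ (3/4 : ℝ)) → ∀ ε : ℝ, 0 < ε → ∃ t₁ ∈ Set.Ioo 0 T, ∀ t ∈ Set.Ico t₁ T, 0 < Zr t ∧ 2 * Sr t - 2 * ν * Pr t ≤ ε * Zr t ^ 3 :=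
  fun _c ν T _hc hν hT u p hmax hLH hdec _Zr _Pr _Sr hZ _ε hε =>
    depletion_of_fderiv_small hν hT hmax hLH hdec (hG ν T hν hT u p hmax hLH hdec) hZ hε

/-- **The gradient criterion along every first blow-up ⟹ the crux `ProductionEfficiencyDecay`, BY NAME.** Implication
between statements about hypothetical blow-ups; the crux is NOT proved. [folklore] -/
theorem productionEfficiencyDecay_of_fderiv_small
    (hG : ∀ (ν T : ℝ), 0 < ν → 0 < T → ∀ (u : ℝ → EuclideanSpace ℝ (Fin 3) → EuclideanSpace ℝ (Fin 3)) (p : ℝ →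
      EuclideanSpace ℝ (Fin 3) → ℝ), Literature.Analysis.FluidPDE.IsMaximalSmoothSolution ν 0 u p T →
      Literature.Analysis.FluidPDE.IsLerayHopfOn T ν 0 (u 0) u → Literature.Analysis.FluidPDE.HasRapidSpatialDecay
      (u 0) → ∀ δ : ℝ, 0 < δ → ∀ᶠ t in nhdsWithin T (Set.Iio T), ∀ x,
      ‖fderiv ℝ (u t) x‖ ≤ δ * ((∫⁻ y, ‖Literature.Analysis.FluidPDE.curl (u t) y‖ₑ ^ 2).toReal) ^ 2) :
    Summit.NavierStokesRegularity.NavierStokesRegularity.Theses.EfficiencyFloor.ProductionEfficiencyDecay := by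
  intro ν T hν hT u p hmax hLH hdec ε hε
  exact efficiencyDecayLaw_of_fderiv_small hν hT hmax hLH hdec (hG ν T hν hT u p hmax hLH hdec) ε hε

/-! ### §4 The Type-I stratum factors through the criterion -/

/-- **Velocity Type I + super-Leray floor ⟹ the gradient criterion.** On a velocity-Type-I blow-up
(`‖∇u(t)‖_∞ ≤ C/(T−t)` near `T` by the landed KNSS rate `LambBudget.gradientTypeIOfTypeI`) the super-Leray floor
(`∀ K`, eventually `K/√(T−t) < Z(t)`) gives, for every `δ > 0`, eventually `‖∇u(t,x)‖ ≤ δ Z(t)²` (floor with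
`K = √(C⁺/δ)`). So `…TypeIStratum.depletion_of_isTypeIBlowup_of_floor` is §1 restricted to the Type-I stratum.
[cite: KochNadirashviliSereginSverak2009, §4 (4.10)] -/
theorem fderiv_small_of_isTypeIBlowup_of_floor {ν T : ℝ} (hν : 0 < ν) (hT : 0 < T)
    {u : ℝ → EuclideanSpace ℝ (Fin 3) → EuclideanSpace ℝ (Fin 3)} {p : ℝ → EuclideanSpace ℝ (Fin 3) → ℝ}
    (hmax : IsMaximalSmoothSolution ν 0 u p T) (hLH : IsLerayHopfOn T ν 0 (u 0) u)
    (hdec : HasRapidSpatialDecay (u 0)) (hI : IsTypeIBlowup u T)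
    (hfloor : ∀ K : ℝ, ∀ᶠ t in 𝓝[<] T, ENNReal.ofReal (K / Real.sqrt (T - t)) < ∫⁻ x, ‖curl (u t) x‖ₑ ^ 2) :
    ∀ δ : ℝ, 0 < δ → ∀ᶠ t in 𝓝[<] T, ∀ x,
      ‖fderiv ℝ (u t) x‖ ≤ δ * ((∫⁻ y, ‖curl (u t) y‖ₑ ^ 2).toReal) ^ 2 := by
  intro δ hδ
  obtain ⟨C, hC⟩ :=
    EnstrophyQuarterLaw.LambBudget.gradientTypeIOfTypeI ν T hν hT u p hmax hLH hdec hI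
  set Cp : ℝ := max C 0 with hCp
  have hCp0 : 0 ≤ Cp := le_max_right _ _
  have hCCp : C ≤ Cp := le_max_left _ _
  set K : ℝ := Real.sqrt (Cp / δ) with hK
  have hK0 : 0 ≤ K := Real.sqrt_nonneg _
  have hK2 : K ^ 2 = Cp / δ := by rw [hK, Real.sq_sqrt (by positivity)]
  -- finiteness of the enstrophy on `(0,T)` from the landed budget
  obtain ⟨c, _, hB⟩ := EnstrophyBudget.main
  obtain ⟨Zr, Pr, Sr, hZ⟩ := hB ν T hν hT u p hmax hLH hdec
  have hIoo : ∀ᶠ t in 𝓝[<] T, t ∈ Ioo 0 T := Ioo_mem_nhdsLT hT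
  filter_upwards [hIoo, hC, hfloor K] with t htI hgrad hfl x
  have hTt : 0 < T - t := sub_pos.2 htI.2
  obtain ⟨hZeq, hZ0, -⟩ := hZ t htI
  rw [hZeq, ENNReal.ofReal_lt_ofReal_iff'] at hfl
  rw [hZeq, ENNReal.toReal_ofReal hZ0]
  have hKZ : K / Real.sqrt (T - t) < Zr t := hfl.1
  -- `Cp/(T−t) ≤ δ Zr²`
  have hsq : Cp / (T - t) < δ * Zr t ^ 2 := by
    have h1 : (K / Real.sqrt (T - t)) ^ 2 < Zr t ^ 2 :=
      pow_lt_pow_left₀ hKZ (div_nonneg hK0 (Real.sqrt_nonneg _)) two_ne_zero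
    have h2 : (K / Real.sqrt (T - t)) ^ 2 = Cp / δ / (T - t) := by
      rw [div_pow, Real.sq_sqrt hTt.le, hK2]
    rw [h2] at h1
    have h3 : Cp / δ / (T - t) = (Cp / (T - t)) / δ := by ring
    rw [h3, div_lt_iff₀ hδ] at h1
    linarith
  calc ‖fderiv ℝ (u t) x‖ ≤ C / (T - t) := hgrad x
    _ ≤ Cp / (T - t) := div_le_div_of_nonneg_right hCCp hTt.le
    _ ≤ δ * Zr t ^ 2 := hsq.le

end GradientCriterion

end ProductionEfficiencyDecay

end Summit.NavierStokesRegularity.NavierStokesRegularity.Theorems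

end
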